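import Summits.CriticalPhenomena.PercolationContinuityZ3.Theorems.PercNearOneGluingNoHeavyLowerTailSahiOneStepVertexX
import Summits.CriticalPhenomena.PercolationContinuityZ3.Theorems.PercNearOneGluingNoHeavyLowerTailSahiOneStepVertexCover
import Summits.CriticalPhenomena.PercolationContinuityZ3.Theorems.PercNearOneGluingNoHeavyLowerTailSahiOneStepClassInduction
import Summits.CriticalPhenomena.PercolationContinuityZ3.Theorems.PercNearOneGluingNoHeavyLowerTailSahiOneStepDensityClosure
import Summits.CriticalPhenomena.PercolationContinuityZ3.Theorems.PercNearOneGluingNoHeavyLowerTailSahiOneStepUniformPrelim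
import Summits.CriticalPhenomena.PercolationContinuityZ3.Theorems.PercNearOneGluingNoHeavyLowerTailSahiOneStepFibreThresholdAll
import Summits.CriticalPhenomena.PercolationContinuityZ3.Theorems.PercNearOneGluingNoHeavyLowerTailSahiOneStepSubblockThresholdFree
import HarnessLib

/-!
# One-step scheme: `(2′)` FOR EVERY VERTEX-COVER (2-CNF) PARTNER (THEOREM 1) and AT CODIMENSION TWO FOR ALL PAIRS (COROLLARY 2), all densities

Support file (prover prim-ineq-prove-3 gen 37; `--supports stmt-CriticalPhenomena-4575`; memo
`run/shared/lean/prim/prim-ineq-prove-3/PROOF-G37-VERTEX-COVER-PARTNERS.md`).  No definitions, no named facts, no sorries.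

Target `(2′) ∀p`: `0 ≤ n_{N_F ≥ t}(A,B) := Cov(A,B) - μ(N_F<t)·Cov(A,B | N_F<t)` for every product measure, block `F`, level `t`, increasing
`F`-determined `A, B`.  Kernel before: `t ≤ 2`, `t ≥ |F|-1`, or `p` constant on `F`.  Here:
* THEOREM 1 `osN_threshold_vc_nonneg` — every `t`, every `p`, `A` any increasing event, `B` a VERTEX-COVER event
  `{ω | Sp ⊆ ω ∧ ∀ (a,b) ∈ E, a ∈ ω ∨ b ∈ ω}` (`Sp ⊆ F`, `E ⊆ F × F`; = increasing `F`-determined events generated by sets of size `≤ 2`).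
  Proof: the class {`∅`} ∪ {vertex-cover events} is section-closed (`vcClass_section_insert/_sdiff`, from `…VertexCover`), so the
  class induction `osN_threshold_nonneg_of_goodPivots_on` applies once every member `≠ ∅, univ` has a good pivot (`vcClass_goodPivot`):
  a forced coordinate / loop vertex is an AND-literal (`goodPivot_of_section_sdiff_empty`); otherwise `exists_X_pivot` gives a vertex
  `e` with `X̃_B(e) ≥ 0` and `psi_of_sections` (THEOREM A, relative LYM via Katona's intersecting shadow theorem) gives `Ψ_B(e) ≥ 0`
  since `B0 = B1 ∩ {N(e) ⊆ ω}`.  Interior densities first, the boundary by continuity (`osN_nonneg_of_forall_interior`).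
* COROLLARY 2 `osN_threshold_codimTwo_nonneg` — `t = |F|-2`, ALL increasing pairs (`B` determined by `F`), every `p`: the `H`-hull of `B`
  (`osN_ind_ind_hgen_le_right`) is the vertex-cover event of the bad pairs `{(a,b) ∈ F² | F ∖ {a,b} ∉ B}` (`hgen_threshold_codimTwo_eq`);
  `osT_threshold_codimTwo_nonneg` — Sahi's `T_H = m⁺_H + n_H ≥ 0` there (`osMp_threshold_nonneg_all`).
-/

noncomputable section

namespace Summit.CriticalPhenomena.PercolationContinuityZ3.Theorems

namespace SahiOneStep

open Finset
open scoped Classical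

variable {ι : Type*}

/-! ## The vertex-cover class is closed under sections -/
section ClassVC

/-- Filtered edges (those avoiding `e`) lie in `F.erase e`. [this work] -/
theorem filter_edges_subset_erase {F : Finset ι} {E : Finset (ι × ι)} (hE : ∀ ab ∈ E, ab.1 ∈ F ∧ ab.2 ∈ F) (e : ι) :
    ∀ ab ∈ E.filter (fun ab => ab.1 ≠ e ∧ ab.2 ≠ e), ab.1 ∈ F.erase e ∧ ab.2 ∈ F.erase e := by
  intro ab hab
  rw [Finset.mem_filter] at hab
  exact ⟨Finset.mem_erase.2 ⟨hab.2.1, (hE ab hab.1).1⟩, Finset.mem_erase.2 ⟨hab.2.2, (hE ab hab.1).2⟩⟩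

/-- The neighbours of `e` in the edge list `E` lie in `F.erase e` when the edges lie in `F` and `(e,e) ∉ E`. [this work] -/
theorem nbrs_subset_erase {F : Finset ι} {E : Finset (ι × ι)} (hE : ∀ ab ∈ E, ab.1 ∈ F ∧ ab.2 ∈ F) {e : ι} (hloop : (e, e) ∉ E) :
    (E.filter fun ab => ab.1 = e).image Prod.snd ∪ (E.filter fun ab => ab.2 = e).image Prod.fst ⊆ F.erase e := by
  intro i hi
  simp only [Finset.mem_union, Finset.mem_image, Finset.mem_filter, Prod.exists] at hi
  rw [Finset.mem_erase]
  rcases hi with ⟨a, b, ⟨hab, ha⟩, rfl⟩ | ⟨a, b, ⟨hab, hb⟩, rfl⟩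
  · refine ⟨fun hbe => hloop ?_, (hE _ hab).2⟩
    have : (a, b) = (e, e) := Prod.ext ha hbe
    exact this ▸ hab
  · refine ⟨fun hae => hloop ?_, (hE _ hab).1⟩
    have : (a, b) = (e, e) := Prod.ext hae hb
    exact this ▸ hab

/-- The inner section of a member of the vertex-cover class (or `∅`) over `F` is in the class over `F.erase e`. [this work] -/
theorem vcClass_section_insert (F : Finset ι) (B : Set (Set ι)) (e : ι)
    (h : B = ∅ ∨ ∃ (Sp : Finset ι) (E : Finset (ι × ι)), Sp ⊆ F ∧ (∀ ab ∈ E, ab.1 ∈ F ∧ ab.2 ∈ F) ∧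
      B = {ω : Set ι | (↑Sp : Set ι) ⊆ ω ∧ ∀ ab ∈ E, ab.1 ∈ ω ∨ ab.2 ∈ ω}) :
    {ω : Set ι | insert e ω ∈ B} = ∅ ∨ ∃ (Sp : Finset ι) (E : Finset (ι × ι)), Sp ⊆ F.erase e ∧
      (∀ ab ∈ E, ab.1 ∈ F.erase e ∧ ab.2 ∈ F.erase e) ∧
      {ω : Set ι | insert e ω ∈ B} = {ω : Set ι | (↑Sp : Set ι) ⊆ ω ∧ ∀ ab ∈ E, ab.1 ∈ ω ∨ ab.2 ∈ ω} := by
  rcases h with rfl | ⟨Sp, E, hSp, hE, rfl⟩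
  · left; ext ω; simp
  · right
    exact ⟨Sp.erase e, E.filter (fun ab => ab.1 ≠ e ∧ ab.2 ≠ e), Finset.erase_subset_erase e hSp,
      filter_edges_subset_erase hE e, section_insert_vc Sp E e⟩

/-- The outer section of a member of the vertex-cover class (or `∅`) over `F` is in the class over `F.erase e`. [this work] -/
theorem vcClass_section_sdiff (F : Finset ι) (B : Set (Set ι)) (e : ι)
    (h : B = ∅ ∨ ∃ (Sp : Finset ι) (E : Finset (ι × ι)), Sp ⊆ F ∧ (∀ ab ∈ E, ab.1 ∈ F ∧ ab.2 ∈ F) ∧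
      B = {ω : Set ι | (↑Sp : Set ι) ⊆ ω ∧ ∀ ab ∈ E, ab.1 ∈ ω ∨ ab.2 ∈ ω}) :
    {ω : Set ι | ω \ {e} ∈ B} = ∅ ∨ ∃ (Sp : Finset ι) (E : Finset (ι × ι)), Sp ⊆ F.erase e ∧
      (∀ ab ∈ E, ab.1 ∈ F.erase e ∧ ab.2 ∈ F.erase e) ∧
      {ω : Set ι | ω \ {e} ∈ B} = {ω : Set ι | (↑Sp : Set ι) ⊆ ω ∧ ∀ ab ∈ E, ab.1 ∈ ω ∨ ab.2 ∈ ω} := by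
  rcases h with rfl | ⟨Sp, E, hSp, hE, rfl⟩
  · left; ext ω; simp
  · by_cases heS : e ∈ Sp
    · left; exact section_sdiff_vc_of_mem Sp E heS
    · by_cases hloop : (e, e) ∈ E
      · left; exact section_sdiff_vc_of_loop Sp E hloop
      · right
        have key := section_sdiff_vc Sp E heS hloop
        refine ⟨_, _, ?_, filter_edges_subset_erase hE e, key⟩
        exact Finset.union_subset (fun i hi => Finset.mem_erase.2 ⟨fun h => heS (h ▸ hi), hSp hi⟩) (nbrs_subset_erase hE hloop)

end ClassVC

section Main

variable [Fintype ι]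

open MeasureTheory
open Literature.Probability.Percolation (DeterminedBy determinedBy_iff)
open Literature.Probability.LatticeModels (prodBernoulli)
open Literature.Probability.Percolation.DecisionTree (ind)

/-- **Good pivots in the vertex-cover class** (memo §2–§3): for an interior product measure, every vertex-cover event `B ≠ ∅, univ`
with data inside a nonempty block `F` has a coordinate `e ∈ F` satisfying both one-step inequalities `X̃_B(e) ≥ 0` and `Ψ_B(e) ≥ 0`:
a forced coordinate or a loop vertex is an AND-literal (`goodPivot_of_section_sdiff_empty`); otherwise `exists_X_pivot` picks a
vertex `e` of the graph with `X̃_B(e) ≥ 0`, and `psi_of_sections` (THEOREM A) gives `Ψ_B(e) ≥ 0` since `B0 = B1 ∩ {N(e) ⊆ ω}`. [this work] -/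
theorem vcClass_goodPivot (p : ι → unitInterval) (hp : ∀ e, 0 < (p e : ℝ) ∧ (p e : ℝ) < 1) (F : Finset ι) (t : ℕ)
    (B : Set (Set ι)) (hB : IsUpperSet B)
    (h : B = ∅ ∨ ∃ (Sp : Finset ι) (E : Finset (ι × ι)), Sp ⊆ F ∧ (∀ ab ∈ E, ab.1 ∈ F ∧ ab.2 ∈ F) ∧
      B = {ω : Set ι | (↑Sp : Set ι) ⊆ ω ∧ ∀ ab ∈ E, ab.1 ∈ ω ∨ ab.2 ∈ ω})
    (hBne : B.Nonempty) (hBu : B ≠ Set.univ) :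
    ∃ e ∈ F,
      (prodBernoulli p).real {ω : Set ι | ((F.erase e).filter (· ∈ ω)).card < t} *
          (prodBernoulli p).real ({ω : Set ι | ω \ {e} ∈ B} ∩ {ω : Set ι | ((F.erase e).filter (· ∈ ω)).card < t + 1}) ≤
        (prodBernoulli p).real {ω : Set ι | ((F.erase e).filter (· ∈ ω)).card < t + 1} *
          (prodBernoulli p).real ({ω : Set ι | insert e ω ∈ B} ∩ {ω : Set ι | ((F.erase e).filter (· ∈ ω)).card < t}) ∧
      (prodBernoulli p).real {ω : Set ι | ((F.erase e).filter (· ∈ ω)).card < t} *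
          (1 - (prodBernoulli p).real {ω : Set ι | insert e ω ∈ B}) *
          ((prodBernoulli p).real {ω : Set ι | ((F.erase e).filter (· ∈ ω)).card < t + 1} *
              (prodBernoulli p).real {ω : Set ι | ω \ {e} ∈ B}
            - (prodBernoulli p).real ({ω : Set ι | ω \ {e} ∈ B} ∩ {ω : Set ι | ((F.erase e).filter (· ∈ ω)).card < t + 1})) ≤
        (prodBernoulli p).real {ω : Set ι | ((F.erase e).filter (· ∈ ω)).card < t + 1} *
          (1 - (prodBernoulli p).real {ω : Set ι | ω \ {e} ∈ B}) *
          ((prodBernoulli p).real {ω : Set ι | ((F.erase e).filter (· ∈ ω)).card < t} *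
              (prodBernoulli p).real {ω : Set ι | insert e ω ∈ B}
            - (prodBernoulli p).real ({ω : Set ι | insert e ω ∈ B} ∩ {ω : Set ι | ((F.erase e).filter (· ∈ ω)).card < t})) := by
  rcases h with rfl | ⟨Sp, E, hSp, hE, rfl⟩
  · exact absurd rfl hBne.ne_empty
  rcases Sp.eq_empty_or_nonempty with hS0 | ⟨i, hi⟩
  swap
  · -- a forced coordinate is an AND-literal, hence a good pivot
    exact ⟨i, hSp hi, goodPivot_of_section_sdiff_empty p (F.erase i) i t hB (section_sdiff_vc_of_mem Sp E hi)⟩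
  subst hS0
  by_cases hdeg : ∃ ab ∈ E, ab.1 = ab.2
  · -- a loop `(a,a)` is a unit clause: `a` is an AND-literal
    obtain ⟨ab, hab, haa⟩ := hdeg
    have hloop : (ab.1, ab.1) ∈ E := by
      have : ab = (ab.1, ab.1) := Prod.ext rfl haa.symm
      exact this ▸ hab
    exact ⟨ab.1, (hE ab hab).1, goodPivot_of_section_sdiff_empty p (F.erase ab.1) ab.1 t hB (section_sdiff_vc_of_loop ∅ E hloop)⟩
  push Not at hdeg
  -- no loops, no forced set: a genuine vertex-cover event of a nonempty graph on `V ⊆ F`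
  have hloopfree : ∀ e, (e, e) ∉ E := fun e h => hdeg (e, e) h rfl
  have hEne : E.Nonempty := by
    rw [Finset.nonempty_iff_ne_empty]
    rintro rfl
    apply hBu
    ext ω
    simp
  set V : Finset ι := E.image Prod.fst ∪ E.image Prod.snd with hV
  have hVF : V ⊆ F := by
    intro i hi
    rw [hV, Finset.mem_union, Finset.mem_image, Finset.mem_image] at hi
    rcases hi with ⟨ab, hab, rfl⟩ | ⟨ab, hab, rfl⟩
    · exact (hE ab hab).1
    · exact (hE ab hab).2
  have hVne : V.Nonempty := by
    obtain ⟨ab, hab⟩ := hEne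
    exact ⟨ab.1, Finset.mem_union_left _ (Finset.mem_image_of_mem _ hab)⟩
  have hnoedge : ∀ e, e ∉ V → (E.filter fun ab => ab.1 = e) = ∅ ∧ (E.filter fun ab => ab.2 = e) = ∅ := by
    intro e heV
    constructor
    · rw [Finset.filter_eq_empty_iff]
      intro ab hab h
      exact heV (Finset.mem_union_left _ (Finset.mem_image.2 ⟨ab, hab, h⟩))
    · rw [Finset.filter_eq_empty_iff]
      intro ab hab h
      exact heV (Finset.mem_union_right _ (Finset.mem_image.2 ⟨ab, hab, h⟩))
  -- coordinates outside the graph are free coordinates of `B`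
  have hfree : ∀ e ∈ F, e ∉ V →
      {ω : Set ι | insert e ω ∈ {ω : Set ι | (↑(∅ : Finset ι) : Set ι) ⊆ ω ∧ ∀ ab ∈ E, ab.1 ∈ ω ∨ ab.2 ∈ ω}} =
        {ω : Set ι | ω \ {e} ∈ {ω : Set ι | (↑(∅ : Finset ι) : Set ι) ⊆ ω ∧ ∀ ab ∈ E, ab.1 ∈ ω ∨ ab.2 ∈ ω}} := by
    intro e _ heV
    rw [section_insert_vc, section_sdiff_vc ∅ E (Finset.notMem_empty e) (hloopfree e), (hnoedge e heV).1, (hnoedge e heV).2]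
    simp
  -- (G2): a vertex with `X̃ ≥ 0`
  obtain ⟨e, heV, hX⟩ := exists_X_pivot p F (fun e _ => hp e) hB (determinedBy_vc hSp hE) t V hVF hVne hfree
  refine ⟨e, hVF heV, hX, ?_⟩
  -- (G3): the Ψ-inequality at the vertex `e`, from THEOREM A via `psi_of_sections`
  have key0 := section_sdiff_vc ∅ E (Finset.notMem_empty e) (hloopfree e)
  rw [Finset.empty_union, vc_eq_inter_supset (((E.filter fun ab => ab.1 = e).image Prod.snd ∪
    (E.filter fun ab => ab.2 = e).image Prod.fst))] at key0
  have key1 := section_insert_vc ∅ E e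
  rw [Finset.erase_empty] at key1
  rw [key0, key1]
  exact psi_of_sections p (F.erase e) _ (nbrs_subset_erase hE (hloopfree e)) (isUpperSet_vc ∅ _)
    (determinedBy_vc (Finset.empty_subset _) (filter_edges_subset_erase hE e)) t

/-- **THEOREM 1 (interior densities).**  For an interior product measure, every block `F`, level `t`, EVERY increasing `A` and every
vertex-cover (2-CNF) event `B = {ω ⊇ Sp, ω meets every edge of E}` with `Sp ⊆ F`, `E ⊆ F × F`:  `0 ≤ n_{N_F ≥ t}(A, B)` — the class
induction `osN_threshold_nonneg_of_goodPivots_on` on the section-closed class {`∅`} ∪ {vertex-cover events}. [this work] -/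
theorem osN_threshold_vc_nonneg_of_interior (p : ι → unitInterval) (hp : ∀ e, 0 < (p e : ℝ) ∧ (p e : ℝ) < 1) (F : Finset ι) (t : ℕ)
    {A : Set (Set ι)} (hA : IsUpperSet A) (Sp : Finset ι) (E : Finset (ι × ι)) (hSp : Sp ⊆ F) (hE : ∀ ab ∈ E, ab.1 ∈ F ∧ ab.2 ∈ F) :
    0 ≤ osN p {ω : Set ι | t ≤ (F.filter (· ∈ ω)).card} (ind A)
      (ind {ω : Set ι | (↑Sp : Set ι) ⊆ ω ∧ ∀ ab ∈ E, ab.1 ∈ ω ∨ ab.2 ∈ ω}) :=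
  osN_threshold_nonneg_of_goodPivots_on p
    (fun F B => B = ∅ ∨ ∃ (Sp : Finset ι) (E : Finset (ι × ι)), Sp ⊆ F ∧ (∀ ab ∈ E, ab.1 ∈ F ∧ ab.2 ∈ F) ∧
      B = {ω : Set ι | (↑Sp : Set ι) ⊆ ω ∧ ∀ ab ∈ E, ab.1 ∈ ω ∨ ab.2 ∈ ω})
    (fun F B e _ h => vcClass_section_insert F B e h) (fun F B e _ h => vcClass_section_sdiff F B e h)
    (fun F t B _ hB h hBne hBu => vcClass_goodPivot p hp F t B hB h hBne hBu) F t hA (isUpperSet_vc Sp E)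
    (Or.inr ⟨Sp, E, hSp, hE, rfl⟩)

/-- **THEOREM 1: `(2′)` FOR EVERY VERTEX-COVER (2-CNF) PARTNER, ALL THRESHOLDS, ALL DENSITIES.**  For every product measure, block `F`,
level `t`, EVERY increasing `A ⊆ 2^ι` and every event `B = {ω ⊇ Sp, ω ∩ {a,b} ≠ ∅ ∀ (a,b) ∈ E}` (`Sp ⊆ F`, `E ⊆ F × F`; these are exactly
the increasing `F`-determined events generated by sets of size `≤ 2`, i.e. whose minimal CNF has clauses of width `≤ 2`):
`0 ≤ n_{N_F ≥ t}(A,B)`, i.e. `Cov(A,B) ≥ μ(N_F < t)·Cov(A,B ∣ N_F < t)` (memo THEOREM 1; boundary densities by continuity,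
`osN_nonneg_of_forall_interior`).  Previously known only for `t ≤ 2`, `t ≥ |F| - 1`, or `p` constant on `F`. [this work] -/
theorem osN_threshold_vc_nonneg (p : ι → unitInterval) (F : Finset ι) (t : ℕ) {A : Set (Set ι)} (hA : IsUpperSet A)
    (Sp : Finset ι) (E : Finset (ι × ι)) (hSp : Sp ⊆ F) (hE : ∀ ab ∈ E, ab.1 ∈ F ∧ ab.2 ∈ F) :
    0 ≤ osN p {ω : Set ι | t ≤ (F.filter (· ∈ ω)).card} (ind A)
      (ind {ω : Set ι | (↑Sp : Set ι) ⊆ ω ∧ ∀ ab ∈ E, ab.1 ∈ ω ∨ ab.2 ∈ ω}) :=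
  osN_nonneg_of_forall_interior _ _ _ (fun q hq => osN_threshold_vc_nonneg_of_interior q hq F t hA Sp E hSp hE) p

/-- THEOREM 1 with the vertex-cover event on the left. [this work] -/
theorem osN_threshold_vc_nonneg' (p : ι → unitInterval) (F : Finset ι) (t : ℕ) {A : Set (Set ι)} (hA : IsUpperSet A)
    (Sp : Finset ι) (E : Finset (ι × ι)) (hSp : Sp ⊆ F) (hE : ∀ ab ∈ E, ab.1 ∈ F ∧ ab.2 ∈ F) :
    0 ≤ osN p {ω : Set ι | t ≤ (F.filter (· ∈ ω)).card}
      (ind {ω : Set ι | (↑Sp : Set ι) ⊆ ω ∧ ∀ ab ∈ E, ab.1 ∈ ω ∨ ab.2 ∈ ω}) (ind A) := by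
  rw [osN_comm]
  exact osN_threshold_vc_nonneg p F t hA Sp E hSp hE

/-- **Sahi's `E₃ ≥ 0` for vertex-cover partners**: `0 ≤ T_{N_F ≥ t}(A,B) = m⁺ + n` for every product measure, every `t`, every increasing `A`
and every vertex-cover event `B` with data in `F` (`osMp_threshold_nonneg_all` + THEOREM 1). [this work] -/
theorem osT_threshold_vc_nonneg (p : ι → unitInterval) (F : Finset ι) (t : ℕ) {A : Set (Set ι)} (hA : IsUpperSet A)
    (Sp : Finset ι) (E : Finset (ι × ι)) (hSp : Sp ⊆ F) (hE : ∀ ab ∈ E, ab.1 ∈ F ∧ ab.2 ∈ F) :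
    0 ≤ osT p {ω : Set ι | t ≤ (F.filter (· ∈ ω)).card} (ind A)
      (ind {ω : Set ι | (↑Sp : Set ι) ⊆ ω ∧ ∀ ab ∈ E, ab.1 ∈ ω ∨ ab.2 ∈ ω}) := by
  rw [osT_eq_osMp_add_osN]
  exact add_nonneg (osMp_threshold_nonneg_all p F t hA (isUpperSet_vc Sp E)) (osN_threshold_vc_nonneg p F t hA Sp E hSp hE)

end Main
/-! ## Small sets of size at most two -/
section Pairs

/-- A set of size `≤ 2` containing `a` is `{a, b}` for some `b` in it. [folklore] -/
theorem eq_pair_of_card_le_two {T : Finset ι} (hT : T.card ≤ 2) {a : ι} (ha : a ∈ T) : ∃ b ∈ T, T = {a, b} := by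
  have h1 : (T.erase a).card ≤ 1 := by rw [Finset.card_erase_of_mem ha]; omega
  rcases (T.erase a).eq_empty_or_nonempty with h0 | ⟨b, hb⟩
  · refine ⟨a, ha, ?_⟩
    rw [Finset.pair_eq_singleton]
    ext j
    refine ⟨fun hj => ?_, fun hj => by rwa [Finset.mem_singleton.1 hj]⟩
    by_contra hja
    rw [Finset.mem_singleton] at hja
    have : j ∈ T.erase a := Finset.mem_erase.2 ⟨hja, hj⟩
    rw [h0] at this
    exact absurd this (Finset.notMem_empty j)
  · refine ⟨b, Finset.mem_of_mem_erase hb, ?_⟩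
    ext j
    rw [Finset.mem_insert, Finset.mem_singleton]
    refine ⟨fun hj => ?_, ?_⟩
    · by_cases hja : j = a
      · exact Or.inl hja
      · exact Or.inr (Finset.card_le_one.1 h1 j (Finset.mem_erase.2 ⟨hja, hj⟩) b hb)
    · rintro (rfl | rfl)
      · exact ha
      · exact Finset.mem_of_mem_erase hb

end Pairs

/-! ## The `H`-hull of an increasing `F`-determined event at codimension two is a vertex-cover event -/
section Hull

open Literature.Probability.Percolation (DeterminedBy determinedBy_iff)

/-- **The hull computation** (memo §5).  For `H = {N_F ≥ |F| - 2}` and an increasing `F`-determined `B ∋ F`, the `H`-generated event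
`B* = {ω | every ω' ⊇ ω with ω' ∈ H lies in B}` is the vertex-cover event of the "bad pairs" `E = {(a,b) ∈ F × F | F ∖ {a,b} ∉ B}`
(diagonal pairs `(a,a)` = bad singletons = forced coordinates). [this work] -/
theorem hgen_threshold_codimTwo_eq (F : Finset ι) {B : Set (Set ι)} (hBF : DeterminedBy B (↑F : Set ι)) (hFB : (↑F : Set ι) ∈ B) :
    {ω : Set ι | ∀ ω' : Set ι, ω ⊆ ω' → ω' ∈ {ω : Set ι | F.card - 2 ≤ (F.filter (· ∈ ω)).card} → ω' ∈ B} =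
      {ω : Set ι | (↑(∅ : Finset ι) : Set ι) ⊆ ω ∧
        ∀ ab ∈ (F ×ˢ F).filter (fun ab => (↑(F \ {ab.1, ab.2}) : Set ι) ∉ B), ab.1 ∈ ω ∨ ab.2 ∈ ω} := by
  rw [determinedBy_iff] at hBF
  ext ω
  simp only [Set.mem_setOf_eq, Finset.coe_empty, Set.empty_subset, true_and, Finset.mem_filter, Finset.mem_product]
  constructor
  · rintro hω ⟨a, b⟩ ⟨⟨ha, hb⟩, hbad⟩
    by_contra hno
    push Not at hno
    apply hbad
    -- the configuration "everything except a, b" is above ω and in H, hence in B; it agrees with `F \ {a,b}` on F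
    have hsub : ω ⊆ (↑({a, b} : Finset ι) : Set ι)ᶜ := by
      intro j hj
      rw [Set.mem_compl_iff, Finset.mem_coe, Finset.mem_insert, Finset.mem_singleton]
      rintro (rfl | rfl)
      · exact hno.1 hj
      · exact hno.2 hj
    have hmem : (↑({a, b} : Finset ι) : Set ι)ᶜ ∈ B := by
      refine hω _ hsub (le_trans ?_ (Finset.card_le_card (s := F \ {a, b}) fun j hj => ?_))
      · exact le_trans (Nat.sub_le_sub_left Finset.card_le_two _) (Finset.le_card_sdiff _ _)
      · rw [Finset.mem_sdiff] at hj
        simp only [Finset.mem_filter, Set.mem_compl_iff, Finset.mem_coe]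
        exact hj
    have hagree : (↑({a, b} : Finset ι) : Set ι)ᶜ ∩ ↑F = (↑(F \ {a, b}) : Set ι) ∩ ↑F := by
      ext j
      simp only [Set.mem_inter_iff, Set.mem_compl_iff, Finset.mem_coe, Finset.mem_sdiff]
      tauto
    rwa [hBF _ _ hagree] at hmem
  · intro hω ω' hle hH
    -- the missed set `T = F ∖ ω'` has at most two elements and `F ∖ T ∈ B`
    set T := F.filter (· ∉ ω') with hT
    have hTc : T.card ≤ 2 := by
      have := Finset.card_filter_add_card_filter_not (s := F) (fun i => i ∈ ω')
      rw [hT]; omega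
    have hagree : ω' ∩ (↑F : Set ι) = (↑(F \ T) : Set ι) ∩ ↑F := by
      ext j
      simp only [Set.mem_inter_iff, Finset.mem_coe, Finset.mem_sdiff, hT, Finset.mem_filter, not_and, not_not]
      tauto
    rw [hBF ω' _ hagree]
    by_contra hbad
    rcases T.eq_empty_or_nonempty with h0 | ⟨a, haT⟩
    · rw [h0, Finset.sdiff_empty] at hbad
      exact hbad hFB
    · obtain ⟨b, hbT, hab⟩ := eq_pair_of_card_le_two hTc haT
      have haF : a ∈ F := (Finset.mem_filter.1 haT).1
      have hbF : b ∈ F := (Finset.mem_filter.1 hbT).1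
      rw [hab] at hbad
      rcases hω (a, b) ⟨⟨haF, hbF⟩, hbad⟩ with h | h
      · exact (Finset.mem_filter.1 haT).2 (hle h)
      · exact (Finset.mem_filter.1 hbT).2 (hle h)

/-- An increasing `F`-determined event not containing `F` is empty. [folklore] -/
theorem eq_empty_of_coe_notMem (F : Finset ι) {B : Set (Set ι)} (hB : IsUpperSet B) (hBF : DeterminedBy B (↑F : Set ι))
    (hFB : (↑F : Set ι) ∉ B) : B = ∅ := by
  rw [determinedBy_iff] at hBF
  ext ω
  simp only [Set.mem_empty_iff_false, iff_false]
  intro hω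
  apply hFB
  have h1 : ω ∩ (↑F : Set ι) ∈ B := by
    rw [← hBF ω (ω ∩ ↑F) (by rw [Set.inter_assoc, Set.inter_self])]
    exact hω
  exact hB Set.inter_subset_right h1

end Hull

/-! ## COROLLARY 2: `(2′)` and `E₃ ≥ 0` at codimension two, all pairs, all densities -/
section Main

variable [Fintype ι]

open MeasureTheory
open Literature.Probability.Percolation (DeterminedBy determinedBy_iff)
open Literature.Probability.LatticeModels (prodBernoulli)
open Literature.Probability.Percolation.DecisionTree (ind)

/-- **COROLLARY 2: `(2′)` AT CODIMENSION TWO FOR ALL INCREASING PAIRS AND ALL DENSITIES.**  For every product measure, block `F`,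
every increasing `A` and every increasing `F`-determined `B`:  `0 ≤ n_{N_F ≥ |F|-2}(A, B)`, i.e. `Cov(A,B) ≥ μ(N_F ≤ |F|-3)·Cov(A,B | N_F ≤ |F|-3)`.
Proof: `H`-generation (`osN_ind_ind_hgen_le_right`) replaces `B` by its hull, a vertex-cover event (`hgen_threshold_codimTwo_eq`),
for which THEOREM 1 (`osN_threshold_vc_nonneg`) applies.  Previously known at codimension `≤ 1` only (`t ≥ |F|-1`). [this work] -/
theorem osN_threshold_codimTwo_nonneg (p : ι → unitInterval) (F : Finset ι) {A B : Set (Set ι)} (hA : IsUpperSet A)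
    (hB : IsUpperSet B) (hBF : DeterminedBy B (↑F : Set ι)) :
    0 ≤ osN p {ω : Set ι | F.card - 2 ≤ (F.filter (· ∈ ω)).card} (ind A) (ind B) := by
  by_cases hFB : (↑F : Set ι) ∈ B
  · refine le_trans ?_ (osN_ind_ind_hgen_le_right p (isUpperSet_threshold F (F.card - 2)) hA hB)
    rw [hgen_threshold_codimTwo_eq F hBF hFB]
    refine osN_threshold_vc_nonneg p F (F.card - 2) hA ∅ _ (Finset.empty_subset F) fun ab hab => ?_
    rw [Finset.mem_filter, Finset.mem_product] at hab
    exact hab.1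
  · rw [eq_empty_of_coe_notMem F hB hBF hFB, osN_ind_ind_empty_right]

/-- The same with the `F`-determined event on the left. [this work] -/
theorem osN_threshold_codimTwo_nonneg' (p : ι → unitInterval) (F : Finset ι) {A B : Set (Set ι)} (hA : IsUpperSet A)
    (hAF : DeterminedBy A (↑F : Set ι)) (hB : IsUpperSet B) :
    0 ≤ osN p {ω : Set ι | F.card - 2 ≤ (F.filter (· ∈ ω)).card} (ind A) (ind B) := by
  rw [osN_comm]
  exact osN_threshold_codimTwo_nonneg p F hB hA hAF

/-- **COROLLARY 2 (Sahi's `E₃ ≥ 0` at codimension two).**  `0 ≤ T_{N_F ≥ |F|-2}(A, B) = m⁺ + n` for every product measure, every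
increasing `A` and every increasing `F`-determined `B` (`osMp_threshold_nonneg_all` + `osN_threshold_codimTwo_nonneg`). [this work] -/
theorem osT_threshold_codimTwo_nonneg (p : ι → unitInterval) (F : Finset ι) {A B : Set (Set ι)} (hA : IsUpperSet A)
    (hB : IsUpperSet B) (hBF : DeterminedBy B (↑F : Set ι)) :
    0 ≤ osT p {ω : Set ι | F.card - 2 ≤ (F.filter (· ∈ ω)).card} (ind A) (ind B) := by
  rw [osT_eq_osMp_add_osN]
  exact add_nonneg (osMp_threshold_nonneg_all p F _ hA hB) (osN_threshold_codimTwo_nonneg p F hA hB hBF)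

end Main

end SahiOneStep

end Summit.CriticalPhenomena.PercolationContinuityZ3.Theorems
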